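import Literature.MathematicalPhysics.QuantumLattice.SmoothingLocalityProofs
import Literature.MathematicalPhysics.QuantumLattice.StabilityDecayCalculusProofs
import HarnessLib

/-!
# The light-cone sum: arithmetic of the Lieb–Robinson shell summation

Top-down layer (seat B) of the formalisation of the Michalakis–Zwolak stability theorem
(hubbard.S19, `Literature.MathematicalPhysics.QuantumLattice.michalakis_zwolak`). To show that
`X⁽¹⁾ = 𝓕^s(Φ Z) − 𝓕⁰(Φ Z)` is `O(ε)` (MZ13 Lemma 1 (v)) one needs, at a FIXED time `u`, a
volume-independent bound on `Σ_{Z'} ‖[V Z', τ_u^{H₀}(Q)]‖` over ALL terms of the perturbation: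
the terms within the light cone of `Q` (distance `≲ |u|`) are bounded trivially and are
`O(|u|^{d+1})` in number, the terms outside are summed with the Lieb–Robinson bound over
distance shells (MZ13 p. 11: "for `k ≥ r'/2` we may use the simple bound … `2‖V_v(k)‖‖O_u(r)‖`").
This file isolates the real arithmetic of that shell sum (`exists_lightCone_sum_bound`): for the
shell profile `g(D, u) = min(1, K e^{−(D−a)/(r₀+1) + c|u|})` beyond `D ≥ a + 1 + r₀` and `1`
before, `Σ_{D<M} (2D+1)^d g(D,u) ≤ A (1+|u|)^{d+1}` with `A` depending on `d, r₀, a, K, c` only.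
No definitions, no named facts (theorems only).
-/

noncomputable section

open Finset

namespace Literature.MathematicalPhysics.QuantumLattice

/-- Reindexing a sum over `D ≥ b` in `range M` by `j = D − b`. [folklore] -/
theorem sum_range_filter_le_eq_sum_range (f : ℕ → ℝ) (b M : ℕ) :
    ∑ D ∈ (range M).filter (fun D => b ≤ D), f (D - b) = ∑ j ∈ range (M - b), f j := by
  have h1 : (range M).filter (fun D => b ≤ D) = Ico b M := by
    ext D; simp only [mem_filter, mem_range, mem_Ico]; omega
  rw [h1, Finset.sum_Ico_eq_sum_range]
  refine sum_congr rfl fun j _ => ?_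
  rw [Nat.add_sub_cancel_left]

/-- **The light-cone shell sum.** For `d r₀ a : ℕ` and `K, c ≥ 0` there is `A ≥ 0` such that for
all `M` and all real `u`,
`Σ_{D<M} (2D+1)^d g(D,u) ≤ A (1+|u|)^{d+1}`, where `g(D,u) = min(1, K e^{−(D−a)/(r₀+1) + c|u|})`
for `D ≥ a + 1 + r₀` and `g(D,u) = 1` otherwise (near shells: trivially bounded, `O(|u|)` of them
of size `O(|u|^d)`; far shells: `e^{−x/2} ≤ (d+2)!/(x/2)^{d+2}` and `Σ 1/(D−a)² ≤ 2`). [folklore] -/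
theorem exists_lightCone_sum_bound (d r₀ a : ℕ) {K c : ℝ} (hK : 0 ≤ K) (hc : 0 ≤ c) :
    ∃ A : ℝ, 0 ≤ A ∧ ∀ (M : ℕ) (u : ℝ),
      ∑ D ∈ range M, (2 * (D : ℝ) + 1) ^ d *
        (if a + 1 + r₀ ≤ D then
          min 1 (K * Real.exp (-(((D : ℝ) - a) / ((r₀ : ℝ) + 1)) + c * |u|)) else 1) ≤
      A * (1 + |u|) ^ (d + 1) := by
  set ρ : ℝ := (r₀ : ℝ) + 1 with hρ
  have hρ0 : 0 < ρ := by positivity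
  -- constants
  set C₃ : ℝ := 2 * a + 2 * r₀ + 4 + 2 * ρ * (2 * c + 2) with hC₃
  have hC₃0 : 0 ≤ C₃ := by positivity
  set K₅ : ℝ := K * (Nat.factorial (d + 2) : ℝ) * (2 * ρ) ^ (d + 2) * (2 * (a : ℝ) + 3) ^ d with hK₅
  have hK₅0 : 0 ≤ K₅ := by positivity
  refine ⟨C₃ ^ (d + 1) + 2 * K₅, by positivity, fun M u => ?_⟩
  set g : ℕ → ℝ := fun D => if a + 1 + r₀ ≤ D then
      min 1 (K * Real.exp (-(((D : ℝ) - a) / ρ) + c * |u|)) else 1 with hg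
  have hg0 : ∀ D, 0 ≤ g D := fun D => by
    simp only [hg]; split_ifs
    · exact le_min zero_le_one (by positivity)
    · exact zero_le_one
  have hg1 : ∀ D, g D ≤ 1 := fun D => by
    simp only [hg]; split_ifs
    · exact min_le_left _ _
    · exact le_rfl
  have hu0 : 0 ≤ |u| := abs_nonneg u
  have hu1 : (1 : ℝ) ≤ 1 + |u| := by linarith
  have hpow1 : (1 : ℝ) ≤ (1 + |u|) ^ (d + 1) := one_le_pow₀ hu1
  -- the far shells
  set far : ℕ → Prop := fun D => a + 1 + r₀ ≤ D ∧ 2 * c * |u| + 2 ≤ ((D : ℝ) - a) / ρ with hfar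
  show ∑ D ∈ range M, (2 * (D : ℝ) + 1) ^ d * g D ≤ (C₃ ^ (d + 1) + 2 * K₅) * (1 + |u|) ^ (d + 1)
  rw [← sum_filter_add_sum_filter_not (range M) far]
  -- (1) the near shells: at most `⌊Dn⌋ + 1` of them, each `≤ (2 Dn + 1)^d`
  set Dn : ℝ := a + 1 + r₀ + ρ * (2 * c * |u| + 2) with hDn
  have hDn0 : 0 ≤ Dn := by positivity
  have hnear_le : ∀ D, ¬ far D → (D : ℝ) ≤ Dn := by
    intro D hD
    simp only [hfar, not_and_or, not_le] at hD
    rcases hD with h | h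
    · have : (D : ℝ) < a + 1 + r₀ := by exact_mod_cast h
      have : 0 ≤ ρ * (2 * c * |u| + 2) := by positivity
      linarith
    · rw [div_lt_iff₀ hρ0] at h
      have h' : (D : ℝ) < a + ρ * (2 * c * |u| + 2) := by linarith
      have : (0 : ℝ) ≤ 1 + r₀ := by positivity
      linarith
  have hnear : ∑ D ∈ (range M).filter (fun D => ¬ far D), (2 * (D : ℝ) + 1) ^ d * g D ≤
      C₃ ^ (d + 1) * (1 + |u|) ^ (d + 1) := by
    have h1 : ∑ D ∈ (range M).filter (fun D => ¬ far D), (2 * (D : ℝ) + 1) ^ d * g D ≤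
        ∑ _D ∈ (range M).filter (fun D => ¬ far D), (2 * Dn + 1) ^ d := by
      refine sum_le_sum fun D hD => ?_
      have hD' := hnear_le D (mem_filter.mp hD).2
      calc (2 * (D : ℝ) + 1) ^ d * g D ≤ (2 * (D : ℝ) + 1) ^ d * 1 :=
            mul_le_mul_of_nonneg_left (hg1 D) (by positivity)
        _ ≤ (2 * Dn + 1) ^ d := by
            rw [mul_one]; exact pow_le_pow_left₀ (by positivity) (by linarith) d
    have h2 : (((range M).filter (fun D => ¬ far D)).card : ℝ) ≤ Dn + 1 := by
      have h3 : ((range M).filter (fun D => ¬ far D)).card ≤ ⌊Dn⌋₊ + 1 := by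
        calc ((range M).filter (fun D => ¬ far D)).card ≤ (range (⌊Dn⌋₊ + 1)).card := by
              refine card_le_card fun D hD => ?_
              rw [mem_range]
              have h4 : (D : ℝ) < (⌊Dn⌋₊ : ℝ) + 1 :=
                (hnear_le D (mem_filter.mp hD).2).trans_lt (Nat.lt_floor_add_one Dn)
              exact_mod_cast h4
          _ = ⌊Dn⌋₊ + 1 := card_range _
      have h5 : ((⌊Dn⌋₊ : ℕ) : ℝ) ≤ Dn := Nat.floor_le hDn0
      calc (((range M).filter (fun D => ¬ far D)).card : ℝ) ≤ ((⌊Dn⌋₊ + 1 : ℕ) : ℝ) := by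
            exact_mod_cast h3
        _ ≤ Dn + 1 := by push_cast; linarith
    have h6 : 2 * Dn + 2 ≤ C₃ * (1 + |u|) := by
      rw [hDn, hC₃]
      have : 2 * c * |u| + 2 ≤ (2 * c + 2) * (1 + |u|) := by nlinarith
      nlinarith [hρ0.le]
    calc ∑ D ∈ (range M).filter (fun D => ¬ far D), (2 * (D : ℝ) + 1) ^ d * g D
        ≤ ∑ _D ∈ (range M).filter (fun D => ¬ far D), (2 * Dn + 1) ^ d := h1
      _ = (((range M).filter (fun D => ¬ far D)).card : ℝ) * (2 * Dn + 1) ^ d := by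
          rw [sum_const, nsmul_eq_mul]
      _ ≤ (Dn + 1) * (2 * Dn + 1) ^ d := mul_le_mul_of_nonneg_right h2 (by positivity)
      _ ≤ (2 * Dn + 2) * (2 * Dn + 2) ^ d :=
          mul_le_mul (by linarith) (pow_le_pow_left₀ (by positivity) (by linarith) d)
            (by positivity) (by positivity)
      _ = (2 * Dn + 2) ^ (d + 1) := by ring
      _ ≤ (C₃ * (1 + |u|)) ^ (d + 1) := pow_le_pow_left₀ (by positivity) h6 _
      _ = C₃ ^ (d + 1) * (1 + |u|) ^ (d + 1) := mul_pow _ _ _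
  -- (2) the far shells: `term ≤ K₅/(D−a)²`
  have hfar_term : ∀ D, far D → (2 * (D : ℝ) + 1) ^ d * g D ≤
      K₅ * (1 / ((((D - (a + 1) : ℕ) : ℝ)) + 1) ^ 2) := by
    intro D hD
    obtain ⟨hD1, hD2⟩ := hD
    have hDa : a + 1 ≤ D := by omega
    set x : ℝ := ((D : ℝ) - a) / ρ with hx
    have hx2 : 2 ≤ x := by
      have : 0 ≤ 2 * c * |u| := by positivity
      linarith
    have hx0 : 0 < x := by linarith
    have hDar : ((D : ℝ) - a) = (((D - (a + 1) : ℕ) : ℝ)) + 1 := by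
      have : (((D - (a + 1) : ℕ) : ℝ)) = (D : ℝ) - (a + 1 : ℕ) := by
        rw [Nat.cast_sub hDa]
      rw [this]; push_cast; ring
    set y : ℝ := (((D - (a + 1) : ℕ) : ℝ)) + 1 with hy
    have hy1 : 1 ≤ y := by rw [hy]; have := Nat.cast_nonneg (α := ℝ) (D - (a + 1)); linarith
    have hy0 : 0 < y := by linarith
    -- `g D ≤ K e^{−x/2}`
    have hg' : g D ≤ K * Real.exp (-(x / 2)) := by
      have hif : g D = min 1 (K * Real.exp (-(((D : ℝ) - a) / ρ) + c * |u|)) := by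
        simp only [hg, if_pos hD1]
      rw [hif, ← hx]
      refine (min_le_right _ _).trans (mul_le_mul_of_nonneg_left (Real.exp_le_exp.mpr ?_) hK)
      linarith
    -- `e^{−x/2} ≤ (d+2)!/(x/2)^{d+2}` and `x = y/ρ`
    have hexp : Real.exp (-(x / 2)) ≤ (Nat.factorial (d + 2) : ℝ) / (x / 2) ^ (d + 2) :=
      exp_neg_le_factorial_div_pow (by positivity) (d + 2)
    have hxy : x = y / ρ := by rw [hx, hDar]
    -- `2D + 1 ≤ (2a+3) y`
    have hDy : 2 * (D : ℝ) + 1 ≤ (2 * (a : ℝ) + 3) * y := by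
      have e1 : 2 * (D : ℝ) + 1 = 2 * y + (2 * a + 1) := by
        have : (D : ℝ) = y + a := by linarith [hDar]
        rw [this]; ring
      rw [e1]
      nlinarith
    have hpowD : (2 * (D : ℝ) + 1) ^ d ≤ (2 * (a : ℝ) + 3) ^ d * y ^ d := by
      rw [← mul_pow]; exact pow_le_pow_left₀ (by positivity) hDy d
    calc (2 * (D : ℝ) + 1) ^ d * g D
        ≤ ((2 * (a : ℝ) + 3) ^ d * y ^ d) * (K * Real.exp (-(x / 2))) :=
          mul_le_mul hpowD hg' (hg0 D) (by positivity)
      _ ≤ ((2 * (a : ℝ) + 3) ^ d * y ^ d) * (K * ((Nat.factorial (d + 2) : ℝ) / (x / 2) ^ (d + 2))) :=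
          mul_le_mul_of_nonneg_left (mul_le_mul_of_nonneg_left hexp hK) (by positivity)
      _ = K₅ * (1 / y ^ 2) := by
          have hρne : ρ ≠ 0 := hρ0.ne'
          have hyne : y ≠ 0 := hy0.ne'
          have e2 : (x / 2) ^ (d + 2) = y ^ (d + 2) / (2 * ρ) ^ (d + 2) := by
            rw [hxy, ← div_pow]; congr 1; field_simp
          rw [e2, hK₅]
          field_simp
          ring
  have hfar : ∑ D ∈ (range M).filter far, (2 * (D : ℝ) + 1) ^ d * g D ≤ 2 * K₅ := by
    calc ∑ D ∈ (range M).filter far, (2 * (D : ℝ) + 1) ^ d * g D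
        ≤ ∑ D ∈ (range M).filter far, K₅ * (1 / ((((D - (a + 1) : ℕ) : ℝ)) + 1) ^ 2) :=
          sum_le_sum fun D hD => hfar_term D (mem_filter.mp hD).2
      _ ≤ ∑ D ∈ (range M).filter (fun D => a + 1 ≤ D),
            K₅ * (1 / ((((D - (a + 1) : ℕ) : ℝ)) + 1) ^ 2) := by
          refine sum_le_sum_of_subset_of_nonneg (fun D hD => ?_) fun _ _ _ => by positivity
          simp only [mem_filter] at hD ⊢
          exact ⟨hD.1, by have := hD.2.1; omega⟩
      _ = K₅ * ∑ j ∈ range (M - (a + 1)), 1 / ((j : ℝ) + 1) ^ 2 := by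
          rw [mul_sum]
          exact sum_range_filter_le_eq_sum_range (fun j => K₅ * (1 / ((j : ℝ) + 1) ^ 2)) (a + 1) M
      _ ≤ K₅ * 2 := mul_le_mul_of_nonneg_left (sum_range_one_div_sq_le_two _) hK₅0
      _ = 2 * K₅ := by ring
  calc ∑ D ∈ (range M).filter far, (2 * (D : ℝ) + 1) ^ d * g D +
        ∑ D ∈ (range M).filter (fun D => ¬ far D), (2 * (D : ℝ) + 1) ^ d * g D
      ≤ 2 * K₅ + C₃ ^ (d + 1) * (1 + |u|) ^ (d + 1) := add_le_add hfar hnear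
    _ ≤ 2 * K₅ * (1 + |u|) ^ (d + 1) + C₃ ^ (d + 1) * (1 + |u|) ^ (d + 1) := by
        have : 2 * K₅ * 1 ≤ 2 * K₅ * (1 + |u|) ^ (d + 1) :=
          mul_le_mul_of_nonneg_left hpow1 (by positivity)
        linarith
    _ = (C₃ ^ (d + 1) + 2 * K₅) * (1 + |u|) ^ (d + 1) := by ring

end Literature.MathematicalPhysics.QuantumLattice
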